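import Literature.Geometry.Lorentzian.LinearChargeConservation
import HarnessLib

/-!
# The moment conditions of Mao–Oh–Tao's Lemma 2.2 are necessary

(trunk G08 = T-LORENTZ; family `gr`; namespace `Literature.Geometry.Lorentzian.MaoOhTao`.)

Lemma 2.2 of Mao–Oh–Tao (arXiv:2308.13031) inverts the linearised constraint operators
`h ↦ ∂_i∂_j h^{ij}` and `π ↦ ∂_i π^{ij}` on the annulus `A_1` with support control, under the
moment conditions `(S2)`: `∫ f · (1, x_1, x_2, x_3) = 0` and `(T2)`: `∫ 𝐟 · (e_1, …, Y_3) = 0`, which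
are forced because "`1, x_1, x_2, x_3` span the kernel of the formal `L²`-adjoint of the double
divergence operator (resp. `e_1, …, Y_3` span the kernel of the formal `L²`-adjoint of the
symmetric divergence operator)" (§2.2, after Lemma 2.2; the flat KIDs of `CoordFlatKIDs.lean`).
This file proves that necessity for compactly supported fields on `ℝ³`, in the coordinate
vocabulary `pd`, `cmp`, `e`, `rotGen` of the annular gluing fact:

* `integral_pd_mul_eq_neg`, `integral_pd_eq_zero` — integration by parts in one direction against
  a `C¹` weight, and `∫ ∂_i f = 0` for `f ∈ C¹_c(ℝ³)` (from the tree's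
  `integral_sum_fderiv_mul_eq_neg_integral_mul_sum_fderiv`);
* `integral_sum_pd_pd_cmp_eq_zero`, `integral_sum_pd_pd_cmp_mul_coord_eq_zero` — **(S2)**:
  `∫ ∂_i∂_j h^{ij} = 0` and `∫ (∂_i∂_j h^{ij}) x_l = 0` for `h ∈ C²_c`;
* `integral_sum_pd_cmp_eq_zero`, `integral_sum_pd_cmp_mul_rotGen_eq_zero` — **(T2)**:
  `∫ ∂_i π^{ij} = 0` and `∫ Σ_j (∂_i π^{ij}) (Y_l)_j = 0` for symmetric `π ∈ C¹_c`
  (`∂_i (Y_l)_j` is antisymmetric, `sum_sum_mul_rotGen_e_eq_zero`).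

The converse (sufficiency, i.e. the existence of the solution operators `S`, `T` of Lemma 2.2) is
the analytic content of the paper and is not treated here. Everything is proved; no definitions,
no named facts.

## References

* Y. Mao, S.-J. Oh, T. Tao, arXiv:2308.13031 (2023), Lemma 2.2 (S2), (T2) and the paragraph
  following it (key `MaoOhTao2023`).
-/

noncomputable section

open scoped RealInnerProductSpace Topology ContDiff
open Filter MeasureTheory

namespace Literature.Geometry.Lorentzian

namespace MaoOhTao

/-! ### Integration by parts against polynomial weights -/

/-- **Integration by parts in one direction**: `∫ ∂_i f · g = −∫ f · ∂_i g` for `f ∈ C¹_c(ℝ³)` and `g ∈ C¹(ℝ³)`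
(no decay needed on `g`). [cite: MaoOhTao2023, Lemma 2.7] -/
theorem integral_pd_mul_eq_neg {f g : E3 → ℝ} (hf : ContDiff ℝ 1 f) (hfc : HasCompactSupport f)
    (hg : ContDiff ℝ 1 g) (i : Fin 3) :
    ∫ x, pd i f x * g x = - ∫ x, f x * pd i g x := by
  have h := integral_sum_fderiv_mul_eq_neg_integral_mul_sum_fderiv hf hfc
    (F := fun m y ↦ if m = i then g y else 0) (fun m ↦ by
      by_cases hm : m = i
      · simp only [hm, if_true]; exact hg
      · simp only [hm, if_false]; exact contDiff_const)
  simp only [mul_ite, mul_zero, Finset.sum_ite_eq', Finset.mem_univ, if_true] at h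
  rw [show (fun x ↦ pd i f x * g x) = fun x ↦ fderiv ℝ f x (e i) * g x from rfl, h]
  congr 1
  refine integral_congr_ae (Eventually.of_forall fun x ↦ ?_)
  show f x * ∑ j, pd j (fun y ↦ if j = i then g y else 0) x = f x * pd i g x
  simp only [pd_ite, Finset.sum_ite_eq', Finset.mem_univ, if_true]

/-- `∫ ∂_i f = 0` for `f ∈ C¹_c(ℝ³)`. [folklore] -/
theorem integral_pd_eq_zero {f : E3 → ℝ} (hf : ContDiff ℝ 1 f) (hfc : HasCompactSupport f) (i : Fin 3) :
    ∫ x, pd i f x = 0 := by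
  have h := integral_pd_mul_eq_neg hf hfc contDiff_const (g := fun _ ↦ (1 : ℝ)) i
  simp only [mul_one] at h
  rw [h]
  simp [pd]

/-- The components of a compactly supported tensor field are compactly supported. [folklore] -/
theorem hasCompactSupport_cmp {g : E3 → E3 →L[ℝ] E3 →L[ℝ] ℝ} (hg : HasCompactSupport g) (i j : Fin 3) :
    HasCompactSupport (cmp g i j) :=
  hg.comp_left (g := fun (B : E3 →L[ℝ] E3 →L[ℝ] ℝ) ↦ B (e i) (e j)) (by simp)

/-- The partial derivatives of a compactly supported function are compactly supported. [folklore] -/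
theorem hasCompactSupport_pd {f : E3 → ℝ} (hfc : HasCompactSupport f) (i : Fin 3) :
    HasCompactSupport (pd i f) :=
  (hfc.fderiv ℝ).comp_left (g := fun (L : E3 →L[ℝ] ℝ) ↦ L (e i)) (by simp)

/-! ### The moment conditions (S2), (T2) of Lemma 2.2 are necessary -/

variable {h π : E3 → E3 →L[ℝ] E3 →L[ℝ] ℝ}

/-- **(S2), monopole**: `∫ ∂_i∂_j h^{ij} = 0` for `h ∈ C²_c(ℝ³)` (the pairing of the double divergence with the static KID
`1`). [cite: MaoOhTao2023, Lemma 2.2 (S2)] -/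
theorem integral_sum_pd_pd_cmp_eq_zero (hh : ContDiff ℝ 2 h) (hc : HasCompactSupport h) :
    ∫ x, ∑ i, ∑ j, pd i (pd j (cmp h i j)) x = 0 := by
  have h1 : ∀ i j, ContDiff ℝ 1 (pd j (cmp h i j)) := fun i j ↦ contDiff_pd (contDiff_cmp hh i j) j
  have h1c : ∀ i j, HasCompactSupport (pd j (cmp h i j)) := fun i j ↦
    hasCompactSupport_pd (hasCompactSupport_cmp hc i j) j
  have hint : ∀ i j, Integrable (pd i (pd j (cmp h i j))) := fun i j ↦
    ((h1 i j).continuous_fderiv one_ne_zero |>.clm_apply continuous_const).integrable_of_hasCompactSupport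
      (hasCompactSupport_pd (h1c i j) i)
  rw [integral_finsetSum _ fun i _ ↦ integrable_finsetSum _ fun j _ ↦ hint i j]
  refine Finset.sum_eq_zero fun i _ ↦ ?_
  rw [integral_finsetSum _ fun j _ ↦ hint i j]
  exact Finset.sum_eq_zero fun j _ ↦ integral_pd_eq_zero (h1 i j) (h1c i j) i

/-- **(S2), dipole**: `∫ (∂_i∂_j h^{ij}) x_l = 0` for `h ∈ C²_c(ℝ³)` (the pairing with the static KIDs `x_l`): the double
divergence of a compactly supported field has neither monopole nor dipole moment — the conditions `(S2)` of Lemma 2.2 are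
necessary. [cite: MaoOhTao2023, Lemma 2.2 (S2)] -/
theorem integral_sum_pd_pd_cmp_mul_coord_eq_zero (hh : ContDiff ℝ 2 h) (hc : HasCompactSupport h) (l : Fin 3) :
    ∫ x, (∑ i, ∑ j, pd i (pd j (cmp h i j)) x) * x l = 0 := by
  have h1 : ∀ i j, ContDiff ℝ 1 (pd j (cmp h i j)) := fun i j ↦ contDiff_pd (contDiff_cmp hh i j) j
  have h1c : ∀ i j, HasCompactSupport (pd j (cmp h i j)) := fun i j ↦
    hasCompactSupport_pd (hasCompactSupport_cmp hc i j) j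
  have hint : ∀ i j, Integrable (fun x : E3 ↦ pd i (pd j (cmp h i j)) x * x l) := fun i j ↦
    (((h1 i j).continuous_fderiv one_ne_zero |>.clm_apply continuous_const).mul
      (EuclideanSpace.proj (𝕜 := ℝ) l).continuous).integrable_of_hasCompactSupport
      ((hasCompactSupport_pd (h1c i j) i).mul_right)
  simp_rw [Finset.sum_mul]
  rw [integral_finsetSum _ fun i _ ↦ integrable_finsetSum _ fun j _ ↦ hint i j]
  refine Finset.sum_eq_zero fun i _ ↦ ?_
  rw [integral_finsetSum _ fun j _ ↦ hint i j]
  refine Finset.sum_eq_zero fun j _ ↦ ?_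
  -- `∫ ∂_i(∂_j h_ij) x_l = −∫ ∂_j h_ij δ_il`, then `∫ ∂_j h_lj = 0`
  rw [integral_pd_mul_eq_neg (h1 i j) (h1c i j) (contDiff_coord l) i]
  simp only [pd_coord, mul_ite, mul_one, mul_zero]
  by_cases hli : l = i
  · simp only [hli, if_true]
    rw [integral_pd_eq_zero ((contDiff_cmp hh i j).of_le (by norm_num)) (hasCompactSupport_cmp hc i j) j,
      neg_zero]
  · simp [hli]

/-- **(T2), translations**: `∫ ∂_i π^{ij} = 0` for `π ∈ C¹_c(ℝ³)` (the pairing with the Killing fields `e_j`).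
[cite: MaoOhTao2023, Lemma 2.2 (T2)] -/
theorem integral_sum_pd_cmp_eq_zero (hπ : ContDiff ℝ 1 π) (hc : HasCompactSupport π) (j : Fin 3) :
    ∫ x, ∑ i, pd i (cmp π i j) x = 0 := by
  have hint : ∀ i, Integrable (pd i (cmp π i j)) := fun i ↦
    ((contDiff_cmp hπ i j).continuous_fderiv one_ne_zero |>.clm_apply continuous_const)
      |>.integrable_of_hasCompactSupport (hasCompactSupport_pd (hasCompactSupport_cmp hc i j) i)
  rw [integral_finsetSum _ fun i _ ↦ hint i]
  exact Finset.sum_eq_zero fun i _ ↦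
    integral_pd_eq_zero (contDiff_cmp hπ i j) (hasCompactSupport_cmp hc i j) i

/-- The matrix `∂_i (Y_l)_j = (Y_l(e_i))_j = ε_{lij}` is antisymmetric, so it pairs to zero with every symmetric matrix.
[cite: MaoOhTao2023, §2.2] -/
theorem sum_sum_mul_rotGen_e_eq_zero {p : Fin 3 → Fin 3 → ℝ} (hp : ∀ i j, p i j = p j i) (l : Fin 3) :
    ∑ i, ∑ j, p i j * rotGen l (e i) j = 0 := by
  simp only [Fin.sum_univ_three, rotGen, e, PiLp.single_apply]
  fin_cases l <;> simp [hp 1 0, hp 2 0, hp 2 1]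

/-- **(T2), rotations**: `∫ Σ_j (∂_i π^{ij}) (Y_l)_j = 0` for symmetric `π ∈ C¹_c(ℝ³)` (the pairing with the Killing fields
`Y_l = e_l × x`; one integration by parts and antisymmetry of `∂_i (Y_l)_j`). With `integral_sum_pd_cmp_eq_zero` these are
the conditions `(T2)` of Lemma 2.2, hence necessary. [cite: MaoOhTao2023, Lemma 2.2 (T2)] -/
theorem integral_sum_pd_cmp_mul_rotGen_eq_zero (hπ : ContDiff ℝ 1 π) (hc : HasCompactSupport π)
    (hsym : ∀ x i j, cmp π i j x = cmp π j i x) (l : Fin 3) :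
    ∫ x, ∑ j, (∑ i, pd i (cmp π i j) x) * rotGen l x j = 0 := by
  have hint : ∀ i j, Integrable (fun x : E3 ↦ pd i (cmp π i j) x * rotGen l x j) := fun i j ↦
    ((((contDiff_cmp hπ i j).continuous_fderiv one_ne_zero).clm_apply continuous_const).mul
      (contDiff_rotGen (n := 1) l j).continuous).integrable_of_hasCompactSupport
      ((hasCompactSupport_pd (hasCompactSupport_cmp hc i j) i).mul_right)
  simp_rw [Finset.sum_mul]
  rw [integral_finsetSum _ fun j _ ↦ integrable_finsetSum _ fun i _ ↦ hint i j]
  have hstep : ∀ i j, ∫ x, pd i (cmp π i j) x * rotGen l x j = - ∫ x, cmp π i j x * rotGen l (e i) j := by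
    intro i j
    rw [integral_pd_mul_eq_neg (contDiff_cmp hπ i j) (hasCompactSupport_cmp hc i j) (contDiff_rotGen l j) i]
    simp only [pd_rotGen]
  simp_rw [integral_finsetSum _ fun i _ ↦ hint i _, hstep]
  -- `Σ_j Σ_i −∫ π_ij R_ij = −∫ Σ_ij π_ij R_ij = 0`
  have hint2 : ∀ i j, Integrable (fun x : E3 ↦ cmp π i j x * rotGen l (e i) j) := fun i j ↦
    ((contDiff_cmp hπ i j).continuous.mul continuous_const).integrable_of_hasCompactSupport
      ((hasCompactSupport_cmp hc i j).mul_right)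
  simp only [Finset.sum_neg_distrib, neg_eq_zero]
  have hinner : ∀ j, ∑ i, ∫ x, cmp π i j x * rotGen l (e i) j = ∫ x, ∑ i, cmp π i j x * rotGen l (e i) j :=
    fun j ↦ (integral_finsetSum _ fun i _ ↦ hint2 i j).symm
  simp only [hinner]
  rw [← integral_finsetSum _ fun j _ ↦ integrable_finsetSum _ fun i _ ↦ hint2 i j]
  have h0 : ∫ x, ∑ j, ∑ i, cmp π i j x * rotGen l (e i) j = ∫ _x : E3, (0 : ℝ) :=
    integral_congr_ae (Eventually.of_forall fun x ↦ by
      show ∑ j, ∑ i, cmp π i j x * rotGen l (e i) j = 0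
      rw [Finset.sum_comm]
      exact sum_sum_mul_rotGen_e_eq_zero (fun i j ↦ hsym x i j) l)
  rw [h0, integral_zero]

end MaoOhTao

end Literature.Geometry.Lorentzian

end
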